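import Summits.QuantumFields.BalabanUV.Beta.SpineRecursiveT2AllSym
import Summits.QuantumFields.BalabanUV.Beta.SpineRecursiveWEnd

/-!
# `BalabanUV.Beta.SpineRecursiveWEndSym` — binder row D1, (N7d-i) of the second-order hR slot port: **THE (Wr-conj-c) LAW OF THE SLOTTED W-TABLES AT THE
# (0.4) LITERAL'S SYMMETRISED RESOLVENTS, AT EVERY LEVEL, FROM THE SECOND-ORDER TABLE LETTERS — IN THE ROOT's CURRENCY** (first-order letters as
# `vertexOfK G_j Lc (SrecOf … j)`, contacts as `vertexOfK G_j Lc (κ u ↦ γ_j • diagK (ctGenM …))`, second-order contact table `X₂ := diagK X2s`, COMPENSATOR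
# `Wc := Rm_j` = the W-remainder) — i.e. the hypothesis `hWrC` of the row-D1 root `RowD1JointEndSymWardTablesAn1` (p273819) DERIVED from the letters
# (β sub-cell, BINDER-OWNERS row D1 OWNER `b2b-balaban-beta-an2`, gen 31; memo `gen30/N7-SCOPE.v1.md` §4 (N7d); slot twin of the (W-ASM) body of
# `SpineRecursiveWEnd` without its END)

HONEST FRAMING (cell charter, verbatim): «discharging BetaPertH makes Bałaban's UV stability UNCONDITIONAL — a real constructive-QFT result; it is
NOT the continuum limit and NOT the Clay problem.»  HONEST DEPENDENCY: continuum YM on T⁴ ⇐ BetaPertH ∧ nine spine estimates (0/9 proved); BetaPertH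
⇐ (D1) ∧ (D4) ∧ CAP+tail; G-an2-4 gates asym, D1 and NE2/3/4.  DERIVED cell leaf (wiring, [folklore]): `SpineRecursiveT2AllSym.T2RecOf_bref_all_of_letters_sym`
(the induction) + `SpineRecursiveWLawSym.WrecOf_bref_of_T2RM_sym` (W-law ⟸ (hT2-rem)) + K2's (c1) fold `LagrangeFoldSym.dM_SpureRecOf_M1Of_eq_vertexOfK_SrecOf`
+ §1; no statement of Bałaban's papers, no `[cite:]`, no `def`, no `Prop` fact; EVERY LETTER IS A HYPOTHESIS; instantiates no binder of the wall BY ITSELF.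
NOT D1, NOT `BetaPertH`, NOT continuum, NOT Clay.

## What is here
* §1 `vertexOfK_smul_diagK_ctGenM`: `vertexOfK K N (κ u ↦ γ • diagK (ctGenM d B α L κ u)) b = diagK (Gᵞ_b)` (twin of `SpineRecursiveWEnd.vertexOfK_smul_diagK_ctGen`).
* §2 **`WrecOf_brefC_of_letters_sym`**: under EXACTLY the hypotheses of `T2RecOf_bref_all_of_letters_sym`, for all `j α μ y ν y′`:
  `W_j μ (bref y) ν (bref y′) = (ε ε) • refK (W_j μ y ν y′ + conjW 𝕄_j (vertexOfK G_j Lc (SrecOf … j) μ y) (vertexOfK G_j Lc (SrecOf … j) ν y′)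
  (vertexOfK G_j Lc (κ u ↦ γ_j • diagK (ctGenM … κ u)) μ y) (…ν y′) (diagK (X2s j α μ y ν y′)) + Rm_j α μ y ν y′)`,
  `Rm_j := ½•conjV 𝕄_j (diagK (X2s_jᵀ − X2s_j)) + ½•(Δ_j + Δ_jᵀ)` — THE ROOT's (Wr-conj-c) SHAPE with `X₂ := diagK X2s`, `Wc := Rm`.
WHAT THIS MEANS FOR THE ROW (located, not a class count): the root's second-order hR letter `hWrC` is no longer a free-standing hypothesis about the
literal's `W` — it FOLLOWS from table-level second-order letters (level-0 Wilson∕border letter, the mixed letter, the border letter at every level), the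
mechanical split identities, the localisations, (V-ff0)(H-r), the shift letters and the locks, with the compensator `Wc` IDENTIFIED as the W-remainder
`Rm` (whose transported part `R2` carries the chart-(II) sandwich-defect words); the root's `hcomp` is then the CONCRETE identity
`½·tadpole G_j (Rm_j …) + conjDefect G_j 𝕄_j (…) (diagK X2s) = 0` — the (N8) object.  The re-rooting itself (N7e) is not in this file.
Provenance: β sub-cell, unit beta-an2 gen 31, 2026-08-21 (v1); no existing file touched.
-/

open Finset
open scoped BigOperators
open Literature.Probability.LatticeModels (Torus.proj)
open Literature.MathematicalPhysics.QuantumFieldTheory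
open Literature.MathematicalPhysics.QuantumFieldTheory.Balaban1983to89
open Literature.MathematicalPhysics.QuantumFieldTheory.Balaban1983to89.Beta
open ExpKernelCalculus (MKer Decays BiLoc comp VertexFamily)
open PolarizationSign (reflSign)
open KernelReflection (refK)
open ResolventReflection (bref Φ)
open OneStepResolventKernel (Fib LocStencil)
open OneStepKernelFamily (KInvStep colH vertexOfK)
open BalabanStepJetsSucc (mmRead wE wVH)
open BalabanStepW2 (M2Of wV4 wB2)
open BalabanCompositeJets (LocStencil₂)
open SecondOrderResponse (dM W2OfK LocStencilFM)
open Summit.QuantumFields.BalabanUV.Beta.TameKernelCalculus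
open Summit.QuantumFields.BalabanUV.Beta.ChartConjugation (conjV conjW)
open Summit.QuantumFields.BalabanUV.Beta.BorderedHessian (bhK diagK stepScale)
open Summit.QuantumFields.BalabanUV.Beta.SymSliceProjectorKernel (symEc)
open Summit.QuantumFields.BalabanUV.Beta.WardLocusCubic (mmSym)
open Summit.QuantumFields.BalabanUV.Beta.WardLocusRecursive (SrecOf)
open Summit.QuantumFields.BalabanUV.Beta.ChartConjugationDefectEnd (sandwichDefect)
open Summit.QuantumFields.BalabanUV.Beta.SymmetrisedStepJets (Gsym)
open Summit.QuantumFields.BalabanUV.Beta.SymShiftedSpread (bhKStepSh)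
open Summit.QuantumFields.BalabanUV.Beta.E3ContactGenerator (ctGenM)
open Summit.QuantumFields.BalabanUV.Beta.VertexReflectionContact (smul_diagK)
open Summit.QuantumFields.BalabanUV.Beta.LagrangeFoldSym (dM_SpureRecOf_M1Of_eq_vertexOfK_SrecOf)

noncomputable section

namespace Summit.QuantumFields.BalabanUV.Beta.SpineRooted

section WEndSym

variable {d Lc : ℕ} [NeZero Lc]

omit [NeZero Lc] in
/-- [folklore] **THE CONTACT LETTER OF THE ROOT IS THE DIAGONAL OF THE DRESSED BORDER-READING GENERATOR**:
`vertexOfK K N (κ u ↦ γ • diagK (ctGenM d B α L κ u)) b = diagK (p c ↦ Σ_κ Σ'_u colH K N b κ u · (γ · ctGenM d B α L κ u p c))`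
(twin of `SpineRecursiveWEnd.vertexOfK_smul_diagK_ctGen`, by its `vertexOfK_diagK_family`). -/
theorem vertexOfK_smul_diagK_ctGenM (K B : MKer (d + 1) (Fib d)) (N L : ℕ) (γ : ℝ) (α μ : Fin (d + 1)) (y : Fin (d + 1) → ℤ) :
    vertexOfK K N (fun κ u => γ • diagK (ctGenM d B α L κ u)) μ y =
      diagK fun p c => ∑ κ, ∑' u, colH K N μ y κ u * (γ * ctGenM d B α L κ u p c) := by
  have e : (fun κ u => γ • diagK (ctGenM d B α L κ u)) = fun κ u => diagK (fun p c => γ * ctGenM d B α L κ u p c) := by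
    funext κ u; exact smul_diagK γ _
  rw [e, vertexOfK_diagK_family]

/-- [folklore] **THE (Wr-conj-c) LAW OF THE SLOTTED W-TABLES AT THE SYMMETRISED RESOLVENTS, EVERY LEVEL, FROM THE LETTERS — ROOT CURRENCY**
(see the module docstring; hypotheses EXACTLY those of `T2RecOf_bref_all_of_letters_sym`). -/
theorem WrecOf_brefC_of_letters_sym (hLc : Odd Lc) {Dsh : MKer (d + 1) (Fib d)} (hDs : Spr Dsh)
    (hDnull : comp (comp (symEc Lc) Dsh) (symEc Lc) = 0)
    (hDff : ∀ (x z : Fin (d + 1) → ℤ) (β β' : Fin (d + 1)), Dsh x z (Sum.inl β) (Sum.inl β') = 0)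
    (hDmm : ∀ (x y : Fin (d + 1) → ℤ) (κ l : Fin (d + 1)), Dsh x y (Sum.inr κ) (Sum.inr l) = 0)
    (hGD : ∀ (j : ℕ) (x z : Fin (d + 1) → ℤ) (m a : Fin (d + 1)), comp (Gsym (d := d) Lc j) Dsh x z (Sum.inr m) (Sum.inl a) = 0)
    (hDG : ∀ (j : ℕ) (x z : Fin (d + 1) → ℤ) (a m : Fin (d + 1)), comp Dsh (Gsym (d := d) Lc j) x z (Sum.inl a) (Sum.inr m) = 0)
    {V H : Fin (d + 1) → (Fin (d + 1) → ℤ) → MKer (d + 1) (Fib d)}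
    (hV : ∀ δ : ℝ, 0 ≤ δ → ∃ C : ℝ, LocStencil V C δ) (hH : ∀ δ : ℝ, 0 ≤ δ → ∃ C : ℝ, VertexFamily H Lc C δ)
    (hV0 : ∀ (κ : Fin (d + 1)) (w x z : Fin (d + 1) → ℤ) (β β' : Fin (d + 1)), V κ w x z (Sum.inl β) (Sum.inl β') = 0)
    (hHr : ∀ (α μ : Fin (d + 1)) (y : Fin (d + 1) → ℤ), H μ (bref α μ y) = reflSign α μ • refK (Φ (d := d) Lc α) (H μ y))
    (cE cVH cΛ cE₂ cB : ℝ) (T : Fin 4 → Fin 4 → Fin 4 → Fin 4 → ℝ)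
    {vh₂S : Fin (d + 1) → (Fin (d + 1) → ℤ) → Fin (d + 1) → (Fin (d + 1) → ℤ) → MKer (d + 1) (Fib d)} (hB2 : ∃ C δ : ℝ, 0 < δ ∧ LocStencil₂ vh₂S C δ)
    (hB0 : ∀ κ u κ' u' (x z : Fin (d + 1) → ℤ) (β β' : Fin (d + 1)), vh₂S κ u κ' u' x z (Sum.inl β) (Sum.inl β') = 0)
    {mixFF : Fin (d + 1) → (Fin (d + 1) → ℤ) → Fin (d + 1) → (Fin (d + 1) → ℤ) → MKer (d + 1) (Fib d)} (hmix : ∃ C δ : ℝ, 0 < δ ∧ LocStencilFM Lc mixFF C δ)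
    (γ : ℕ → ℝ)
    (hlock : ∀ j, cE * wE d Lc (j + 1) * (γ j / (stepScale d Lc j * (Lc : ℝ) ^ (d + 1))) / wVH d Lc (j + 1) = γ (j + 1))
    (hlock2 : ∀ j, cE₂ * wV4 d Lc (j + 1) * wVH d Lc (j + 1) = (cE * wE d Lc (j + 1)) ^ 2)
    (hSp : ∀ (j : ℕ) (α κ : Fin (d + 1)) (u : Fin (d + 1) → ℤ), SpureRecOf d Lc V H (Gsym Lc) cE cVH cΛ j κ (bref α κ u) = reflSign α κ • refK (Φ Lc α)
      (SpureRecOf d Lc V H (Gsym Lc) cE cVH cΛ j κ u + conjV (bhKStepSh d Lc Dsh j) (diagK fun p c => γ j * ctGenM d (bhK Lc + Dsh) α Lc κ u p c)))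
    (h : ℕ → Fin (d + 1) → Fin (d + 1) → (Fin (d + 1) → ℤ) → Fin (d + 1) → (Fin (d + 1) → ℤ) → (Fin (d + 1) → ℤ) → Fib d → ℝ)
    (R2 : ℕ → Fin (d + 1) → Fin (d + 1) → (Fin (d + 1) → ℤ) → Fin (d + 1) → (Fin (d + 1) → ℤ) → MKer (d + 1) (Fib d))
    (RM : ℕ → Fin (d + 1) → Fin (d + 1) → (Fin (d + 1) → ℤ) → Fin (d + 1) → (Fin (d + 1) → ℤ) → MKer (d + 1) (Fib d))
    (h0 : ∀ (α κ : Fin (d + 1)) (u : Fin (d + 1) → ℤ) (κ' : Fin (d + 1)) (u' : Fin (d + 1) → ℤ),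
      T2RecOf d Lc (Gsym Lc) (SpureRecOf d Lc V H (Gsym Lc) cE cVH cΛ) (M1Of d Lc H cΛ) cE₂ cB T vh₂S mixFF 0 κ (bref α κ u) κ' (bref α κ' u') =
        (reflSign α κ * reflSign α κ') • refK (Φ Lc α)
          (T2RecOf d Lc (Gsym Lc) (SpureRecOf d Lc V H (Gsym Lc) cE cVH cΛ) (M1Of d Lc H cΛ) cE₂ cB T vh₂S mixFF 0 κ u κ' u' +
            conjW (bhKStepSh d Lc Dsh 0) (SpureRecOf d Lc V H (Gsym Lc) cE cVH cΛ 0 κ u) (SpureRecOf d Lc V H (Gsym Lc) cE cVH cΛ 0 κ' u')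
              (diagK fun p c => γ 0 * ctGenM d (bhK Lc + Dsh) α Lc κ u p c) (diagK fun p c => γ 0 * ctGenM d (bhK Lc + Dsh) α Lc κ' u' p c) (diagK (h 0 α κ u κ' u')) +
            R2 0 α κ u κ' u'))
    (hM2 : ∀ (j : ℕ) (α κ : Fin (d + 1)) (u : Fin (d + 1) → ℤ) (ρ : Fin (d + 1)) (w : Fin (d + 1) → ℤ),
      M2Of d Lc mixFF j κ (bref α κ u) ρ (bref α ρ w) =
        (reflSign α κ * reflSign α ρ) • refK (Φ Lc α)
          (M2Of d Lc mixFF j κ u ρ w + conjV (M1Of d Lc H cΛ j ρ w) (diagK fun p c => γ j * ctGenM d (bhK Lc + Dsh) α Lc κ u p c) + RM j α κ u ρ w))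
    (X2s : ℕ → Fin (d + 1) → Fin (d + 1) → (Fin (d + 1) → ℤ) → Fin (d + 1) → (Fin (d + 1) → ℤ) → (Fin (d + 1) → ℤ) → Fib d → ℝ)
    (Δ : ℕ → Fin (d + 1) → Fin (d + 1) → (Fin (d + 1) → ℤ) → Fin (d + 1) → (Fin (d + 1) → ℤ) → MKer (d + 1) (Fib d))
    (hsplit : ∀ (j : ℕ) (α μ : Fin (d + 1)) (y : Fin (d + 1) → ℤ) (ν : Fin (d + 1)) (y' : Fin (d + 1) → ℤ),
      W2OfK (Gsym (d := d) Lc j) Lc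
          (fun κ u => SpureRecOf d Lc V H (Gsym Lc) cE cVH cΛ j κ u + conjV (bhKStepSh d Lc Dsh j) (diagK fun p c => γ j * ctGenM d (bhK Lc + Dsh) α Lc κ u p c))
          (M1Of d Lc H cΛ j)
          (fun κ u κ' u' => T2RecOf d Lc (Gsym Lc) (SpureRecOf d Lc V H (Gsym Lc) cE cVH cΛ) (M1Of d Lc H cΛ) cE₂ cB T vh₂S mixFF j κ u κ' u' +
            conjW (bhKStepSh d Lc Dsh j) (SpureRecOf d Lc V H (Gsym Lc) cE cVH cΛ j κ u) (SpureRecOf d Lc V H (Gsym Lc) cE cVH cΛ j κ' u')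
              (diagK fun p c => γ j * ctGenM d (bhK Lc + Dsh) α Lc κ u p c) (diagK fun p c => γ j * ctGenM d (bhK Lc + Dsh) α Lc κ' u' p c) (diagK (h j α κ u κ' u')) +
            R2 j α κ u κ' u')
          (fun κ u ρ w => M2Of d Lc mixFF j κ u ρ w + conjV (M1Of d Lc H cΛ j ρ w) (diagK fun p c => γ j * ctGenM d (bhK Lc + Dsh) α Lc κ u p c) + RM j α κ u ρ w)
          μ y ν y' =
        W2OfK (Gsym (d := d) Lc j) Lc (SpureRecOf d Lc V H (Gsym Lc) cE cVH cΛ j) (M1Of d Lc H cΛ j) (T2RecOf d Lc (Gsym Lc) (SpureRecOf d Lc V H (Gsym Lc) cE cVH cΛ) (M1Of d Lc H cΛ) cE₂ cB T vh₂S mixFF j) (M2Of d Lc mixFF j) μ y ν y' +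
          conjW (bhKStepSh d Lc Dsh j)
            (dM (Gsym Lc j) Lc (SpureRecOf d Lc V H (Gsym Lc) cE cVH cΛ j) (M1Of d Lc H cΛ j) μ y) (dM (Gsym Lc j) Lc (SpureRecOf d Lc V H (Gsym Lc) cE cVH cΛ j) (M1Of d Lc H cΛ j) ν y')
            (diagK fun p c => ∑ κ, ∑' u, colH (Gsym Lc j) Lc μ y κ u * (γ j * ctGenM d (bhK Lc + Dsh) α Lc κ u p c)) (diagK fun p c => ∑ κ, ∑' u, colH (Gsym Lc j) Lc ν y' κ u * (γ j * ctGenM d (bhK Lc + Dsh) α Lc κ u p c))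
            (diagK (X2s j α μ y ν y')) +
          Δ j α μ y ν y')
    (hDg : ∀ (j : ℕ) (α ν : Fin (d + 1)) (y' : Fin (d + 1) → ℤ),
      Loc (dM (Gsym (d := d) Lc j) Lc (fun κ u => SpureRecOf d Lc V H (Gsym Lc) cE cVH cΛ j κ u + conjV (bhKStepSh d Lc Dsh j) (diagK fun p c => γ j * ctGenM d (bhK Lc + Dsh) α Lc κ u p c)) (M1Of d Lc H cΛ j) ν y'))
    (hX2L : ∀ j α μ y ν y', Loc (diagK (X2s j α μ y ν y'))) (hΔL : ∀ j α μ y ν y', Loc (Δ j α μ y ν y'))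
    (RB : ℕ → Fin (d + 1) → Fin (d + 1) → (Fin (d + 1) → ℤ) → Fin (d + 1) → (Fin (d + 1) → ℤ) → MKer (d + 1) (Fib d))
    (hRBff : ∀ j α κ u κ' u' (x z : Fin (d + 1) → ℤ) (β β' : Fin (d + 1)), RB j α κ u κ' u' x z (Sum.inl β) (Sum.inl β') = 0)
    (hBfm : ∀ (j : ℕ) (α : Fin (d + 1)) κ u κ' u' (x z : Fin (d + 1) → ℤ) (β m : Fin (d + 1)),
      ((cB * wB2 d Lc (j + 1)) • vh₂S κ (bref α κ u) κ' (bref α κ' u')) x z (Sum.inl β) (Sum.inr m) =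
        ((reflSign α κ * reflSign α κ') • refK (Φ Lc α) ((cB * wB2 d Lc (j + 1)) • vh₂S κ u κ' u' +
          conjW (bhKStepSh d Lc Dsh (j + 1)) (SpureRecOf d Lc V H (Gsym Lc) cE cVH cΛ (j + 1) κ u) (SpureRecOf d Lc V H (Gsym Lc) cE cVH cΛ (j + 1) κ' u')
            (diagK fun p c => γ (j + 1) * ctGenM d (bhK Lc + Dsh) α Lc κ u p c) (diagK fun p c => γ (j + 1) * ctGenM d (bhK Lc + Dsh) α Lc κ' u' p c)
            (diagK (h (j + 1) α κ u κ' u')) + RB (j + 1) α κ u κ' u')) x z (Sum.inl β) (Sum.inr m))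
    (hBmf : ∀ (j : ℕ) (α : Fin (d + 1)) κ u κ' u' (x z : Fin (d + 1) → ℤ) (m β : Fin (d + 1)),
      ((cB * wB2 d Lc (j + 1)) • vh₂S κ (bref α κ u) κ' (bref α κ' u')) x z (Sum.inr m) (Sum.inl β) =
        ((reflSign α κ * reflSign α κ') • refK (Φ Lc α) ((cB * wB2 d Lc (j + 1)) • vh₂S κ u κ' u' +
          conjW (bhKStepSh d Lc Dsh (j + 1)) (SpureRecOf d Lc V H (Gsym Lc) cE cVH cΛ (j + 1) κ u) (SpureRecOf d Lc V H (Gsym Lc) cE cVH cΛ (j + 1) κ' u')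
            (diagK fun p c => γ (j + 1) * ctGenM d (bhK Lc + Dsh) α Lc κ u p c) (diagK fun p c => γ (j + 1) * ctGenM d (bhK Lc + Dsh) α Lc κ' u' p c)
            (diagK (h (j + 1) α κ u κ' u')) + RB (j + 1) α κ u κ' u')) x z (Sum.inr m) (Sum.inl β))
    (hBmm : ∀ (j : ℕ) (α : Fin (d + 1)) κ u κ' u' (x z : Fin (d + 1) → ℤ) (m m' : Fin (d + 1)),
      ((cB * wB2 d Lc (j + 1)) • vh₂S κ (bref α κ u) κ' (bref α κ' u')) x z (Sum.inr m) (Sum.inr m') =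
        ((reflSign α κ * reflSign α κ') • refK (Φ Lc α) ((cB * wB2 d Lc (j + 1)) • vh₂S κ u κ' u' +
          conjW (bhKStepSh d Lc Dsh (j + 1)) (SpureRecOf d Lc V H (Gsym Lc) cE cVH cΛ (j + 1) κ u) (SpureRecOf d Lc V H (Gsym Lc) cE cVH cΛ (j + 1) κ' u')
            (diagK fun p c => γ (j + 1) * ctGenM d (bhK Lc + Dsh) α Lc κ u p c) (diagK fun p c => γ (j + 1) * ctGenM d (bhK Lc + Dsh) α Lc κ' u' p c)
            (diagK (h (j + 1) α κ u κ' u')) + RB (j + 1) α κ u κ' u')) x z (Sum.inr m) (Sum.inr m'))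
    (hR2succ : ∀ (j : ℕ) (α κ : Fin (d + 1)) (u : Fin (d + 1) → ℤ) (κ' : Fin (d + 1)) (u' : Fin (d + 1) → ℤ),
      R2 (j + 1) α κ u κ' u' =
          (-((cE₂ * wV4 d Lc (j + 1)) • mmRead Lc
              (comp (comp (Gsym Lc j) (((1 / 2 : ℝ) • conjV (bhKStepSh d Lc Dsh j) (diagK fun p a => X2s j α κ' u' κ u p a - X2s j α κ u κ' u' p a) +
                (1 / 2 : ℝ) • (Δ j α κ u κ' u' + Δ j α κ' u' κ u)))) (Gsym Lc j) -
                (comp (sandwichDefect (Gsym Lc j) (bhKStepSh d Lc Dsh j)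
                      (diagK fun p c => ∑ ι, ∑' v, colH (Gsym Lc j) Lc κ u ι v * (γ j * ctGenM d (bhK Lc + Dsh) α Lc ι v p c)))
                    (comp (dM (Gsym Lc j) Lc (SpureRecOf d Lc V H (Gsym Lc) cE cVH cΛ j) (M1Of d Lc H cΛ j) κ' u') (Gsym Lc j) -
                      diagK fun p c => ∑ ι, ∑' v, colH (Gsym Lc j) Lc κ' u' ι v * (γ j * ctGenM d (bhK Lc + Dsh) α Lc ι v p c))
                  + comp (comp (Gsym Lc j) (dM (Gsym Lc j) Lc (SpureRecOf d Lc V H (Gsym Lc) cE cVH cΛ j) (M1Of d Lc H cΛ j) κ u +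
                      conjV (bhKStepSh d Lc Dsh j) (diagK fun p c => ∑ ι, ∑' v, colH (Gsym Lc j) Lc κ u ι v * (γ j * ctGenM d (bhK Lc + Dsh) α Lc ι v p c))))
                    (sandwichDefect (Gsym Lc j) (bhKStepSh d Lc Dsh j)
                      (diagK fun p c => ∑ ι, ∑' v, colH (Gsym Lc j) Lc κ' u' ι v * (γ j * ctGenM d (bhK Lc + Dsh) α Lc ι v p c)))
                  + comp (sandwichDefect (Gsym Lc j) (bhKStepSh d Lc Dsh j)
                      (diagK fun p c => ∑ ι, ∑' v, colH (Gsym Lc j) Lc κ' u' ι v * (γ j * ctGenM d (bhK Lc + Dsh) α Lc ι v p c)))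
                    (comp (dM (Gsym Lc j) Lc (SpureRecOf d Lc V H (Gsym Lc) cE cVH cΛ j) (M1Of d Lc H cΛ j) κ u) (Gsym Lc j) -
                      diagK fun p c => ∑ ι, ∑' v, colH (Gsym Lc j) Lc κ u ι v * (γ j * ctGenM d (bhK Lc + Dsh) α Lc ι v p c))
                  + comp (comp (Gsym Lc j) (dM (Gsym Lc j) Lc (SpureRecOf d Lc V H (Gsym Lc) cE cVH cΛ j) (M1Of d Lc H cΛ j) κ' u' +
                      conjV (bhKStepSh d Lc Dsh j) (diagK fun p c => ∑ ι, ∑' v, colH (Gsym Lc j) Lc κ' u' ι v * (γ j * ctGenM d (bhK Lc + Dsh) α Lc ι v p c))))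
                    (sandwichDefect (Gsym Lc j) (bhKStepSh d Lc Dsh j)
                      (diagK fun p c => ∑ ι, ∑' v, colH (Gsym Lc j) Lc κ u ι v * (γ j * ctGenM d (bhK Lc + Dsh) α Lc ι v p c)))))) +
            RB (j + 1) α κ u κ' u' +
            conjV (mmRead Lc (Gsym (d := d) Lc j))
              (diagK fun p c => cE₂ * wV4 d Lc (j + 1) * mmSym Lc (X2s j α κ u κ' u') p c - wVH d Lc (j + 1) * h (j + 1) α κ u κ' u' p c))) :
    ∀ (j : ℕ) (α μ : Fin (d + 1)) (y : Fin (d + 1) → ℤ) (ν : Fin (d + 1)) (y' : Fin (d + 1) → ℤ),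
      WrecOf d Lc (Gsym Lc) (SpureRecOf d Lc V H (Gsym Lc) cE cVH cΛ) (M1Of d Lc H cΛ) cE₂ cB T vh₂S mixFF j μ (bref α μ y) ν (bref α ν y') =
        (reflSign α μ * reflSign α ν) • refK (Φ Lc α)
          (WrecOf d Lc (Gsym Lc) (SpureRecOf d Lc V H (Gsym Lc) cE cVH cΛ) (M1Of d Lc H cΛ) cE₂ cB T vh₂S mixFF j μ y ν y' +
            conjW (bhKStepSh d Lc Dsh j)
              (vertexOfK (Gsym (d := d) Lc j) Lc (SrecOf d Lc V H (Gsym Lc) cE cVH cΛ j) μ y)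
              (vertexOfK (Gsym (d := d) Lc j) Lc (SrecOf d Lc V H (Gsym Lc) cE cVH cΛ j) ν y')
              (vertexOfK (Gsym (d := d) Lc j) Lc (fun κ u => γ j • diagK (ctGenM d (bhK Lc + Dsh) α Lc κ u)) μ y)
              (vertexOfK (Gsym (d := d) Lc j) Lc (fun κ u => γ j • diagK (ctGenM d (bhK Lc + Dsh) α Lc κ u)) ν y')
              (diagK (X2s j α μ y ν y')) +
            ((1 / 2 : ℝ) • conjV (bhKStepSh d Lc Dsh j) (diagK fun p a => X2s j α ν y' μ y p a - X2s j α μ y ν y' p a) +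
              (1 / 2 : ℝ) • (Δ j α μ y ν y' + Δ j α ν y' μ y))) := by
  intro j α μ y ν y'
  have hT2 := T2RecOf_bref_all_of_letters_sym hLc hDs hDnull hDff hDmm hGD hDG hV hH hV0 hHr cE cVH cΛ cE₂ cB T hB2 hB0 hmix γ hlock hlock2 hSp h R2
    RM h0 hM2 X2s Δ hsplit hDg hX2L hΔL RB hRBff hBfm hBmf hBmm hR2succ
  rw [← dM_SpureRecOf_M1Of_eq_vertexOfK_SrecOf hV hH cE cVH cΛ j μ y, ← dM_SpureRecOf_M1Of_eq_vertexOfK_SrecOf hV hH cE cVH cΛ j ν y',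
    vertexOfK_smul_diagK_ctGenM, vertexOfK_smul_diagK_ctGenM]
  exact WrecOf_bref_of_T2RM_sym hLc hHr cE cVH cΛ cE₂ cB T vh₂S mixFF γ j α (hSp j α) (h j α) (R2 j α) (RM j α) (hT2 j α) (hM2 j α) (X2s j α)
    (Δ j α) (hsplit j α) (hDg j α) μ y ν y'

end WEndSym

end Summit.QuantumFields.BalabanUV.Beta.SpineRooted

end
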